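import Summits.NavierStokesRegularity.NavierStokesRegularity.Theorems.PerpetualPumpThesisBesovDuhamelBoundSymbols
import Literature.Analysis.FluidPDE.CriticalRegularityProofs
import Literature.Analysis.FunctionSpaces.LittlewoodPaleyConvergenceProofs

/-!
# Stub `besovDuhamelBound` for `PerpetualPump.Thesis`, part VII: rotated and non-dyadically
# dilated blocks on `Ḃ⁰_{∞,1}`

Support file (part 7 of the stub `besovDuhamelBound` of line `SketchIdeator2`, crux
stmt-NavierStokesRegularity-1832). Tao's averaging (J. Amer. Math. Soc. 29 (2016), (1.12)) conjugates
the Euler operator by rotations `Rot_R` and dilations `Dil_λ`, `λ ∈ [C⁻¹, C]`; on the dyadic blocks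
these act as the Fourier multipliers `φ_k(λ R ·) = φ₀(2^{-k} λ R ·)` — bumps living on the annulus
`|ξ| ∼ 2ᵏ/λ` which are **not** dyadic blocks (the cut-off of the tree is not known to be radial, and
`λ` is not a power of `2`). This file proves that such annular multipliers are nevertheless bounded
by finitely many neighbouring blocks, uniformly:

* `FA.exists_eLpNormDistrib_annularMultiplier_le`: for `2^{-N} ≤ ρ ≤ 2^{N}`, every linear isometry
  `L` and every `k`,
  `‖φ₀(2^{-k}ρ L D) u‖_{L^∞} ≤ C_N ∑_{|k'-k| ≤ N+1} ‖Δ̇_{k'} u‖_{L^∞}` (the symbol is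
  `∑_{|k'-k|≤N+1} φ₀(2^{-k}ρL ·) φ_{k'}` by the dyadic partition of unity, and each piece is an
  admissible multiplier on `Δ̇_{k'}` with universal constants — BCD Lemma 2.2 via part II);
* `FA.tsum_sum_Icc_shift`: `∑_k ∑_{|k'-k| ≤ M} a_{k'} = (2M+1) ∑_k a_k`;
* `FA.exists_tsum_eLpNormDistrib_annularMultiplier_le`: summing over `k`,
  `∑_k ‖φ₀(2^{-k}ρ L D) u‖_{L^∞} ≤ C'_N ‖u‖_{Ḃ⁰_{∞,1}}` — the block-level core of
  "`Rot_R`, `Dil_λ` are bounded on `Ḃ⁰_{∞,1}`, uniformly for `λ` in a compact range".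

## References

* H. Bahouri, J.-Y. Chemin, R. Danchin, *Fourier Analysis and Nonlinear PDE* (2011), Prop. 2.10,
  Lemma 2.2, Prop. 2.18 (dilations).
* T. Tao, J. Amer. Math. Soc. 29 (2016), 601–674, (1.11)–(1.12).
-/

noncomputable section

open MeasureTheory TemperedDistribution SchwartzMap Filter Topology Function
open scoped SchwartzMap ENNReal NNReal Real ContDiff

set_option linter.dupNamespace false

namespace Summit.NavierStokesRegularity.NavierStokesRegularity.Theorems.PerpetualPumpThesis.FA

open Literature.Analysis.FunctionSpaces Literature.Analysis.FluidPDE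

variable {E : Type*} [NormedAddCommGroup E] [InnerProductSpace ℝ E] [FiniteDimensional ℝ E]

/-! ### Where the dyadic symbols live -/

omit [FiniteDimensional ℝ E] in
/-- If `φ_j(ξ) ≠ 0` then `2^{j-1} < ‖ξ‖ < 2^{j+1}` (BCD Prop. 2.10). -/
theorem norm_bounds_of_dyadicSymbol_ne_zero {j : ℤ} {ξ : E} (h : dyadicSymbol j ξ ≠ 0) :
    (2 : ℝ) ^ (j - 1) < ‖ξ‖ ∧ ‖ξ‖ < (2 : ℝ) ^ (j + 1) := by
  constructor
  · by_contra hle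
    exact h (dyadicSymbol_apply_of_norm_le_holds (not_lt.1 hle))
  · by_contra hle
    exact h (dyadicSymbol_apply_of_le_norm_holds (not_lt.1 hle))

omit [FiniteDimensional ℝ E] in
/-- **Support bookkeeping for the annular bump `φ₀(2^{-k}ρ L ·)`**: if `2^{-N} ≤ ρ ≤ 2^N`, `L` is
a linear isometry and both `φ₀(2^{-k}ρ Lξ)` and `φ_{k'}(ξ)` are nonzero, then `|k' - k| ≤ N + 1`. -/
theorem mem_Icc_of_annular_ne_zero {N : ℕ} {ρ : ℝ} (hρ₁ : (2 : ℝ) ^ (-(N : ℤ)) ≤ ρ)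
    (hρ₂ : ρ ≤ (2 : ℝ) ^ (N : ℤ)) (L : E ≃ₗᵢ[ℝ] E) {k k' : ℤ} {ξ : E}
    (hg : dyadicSymbol 0 ((((2 : ℝ) ^ (-k)) * ρ) • L ξ) ≠ 0) (hk' : dyadicSymbol k' ξ ≠ 0) :
    k' ∈ Finset.Icc (k - (N + 1 : ℕ)) (k + (N + 1 : ℕ)) := by
  have hρ0 : 0 < ρ := lt_of_lt_of_le (zpow_pos two_pos _) hρ₁
  obtain ⟨h1, h2⟩ := norm_bounds_of_dyadicSymbol_ne_zero hg
  obtain ⟨h3, h4⟩ := norm_bounds_of_dyadicSymbol_ne_zero hk'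
  rw [norm_smul, L.norm_map, Real.norm_of_nonneg (mul_nonneg (zpow_nonneg zero_le_two _) hρ0.le)]
    at h1 h2
  simp only [zero_sub, zero_add, zpow_one] at h1 h2
  have hA : 0 < (2 : ℝ) ^ (-k) * ρ := mul_pos (zpow_pos two_pos _) hρ0
  rw [Finset.mem_Icc]
  push_cast
  constructor
  · -- lower bound: otherwise `2^{-k}ρ‖ξ‖ ≤ 2^{-k} 2^N 2^{k'+1} ≤ 2^{-1}`
    by_contra hlt
    push Not at hlt
    have hk'le : k' + 1 ≤ k - N - 1 := by omega
    have : (2 : ℝ) ^ (-k) * ρ * ‖ξ‖ ≤ (2 : ℝ) ^ (-1 : ℤ) := by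
      calc (2 : ℝ) ^ (-k) * ρ * ‖ξ‖ ≤ (2 : ℝ) ^ (-k) * (2 : ℝ) ^ (N : ℤ) * (2 : ℝ) ^ (k' + 1) := by
            gcongr
          _ ≤ (2 : ℝ) ^ (-k) * (2 : ℝ) ^ (N : ℤ) * (2 : ℝ) ^ (k - N - 1) :=
            mul_le_mul_of_nonneg_left (zpow_le_zpow_right₀ (one_le_two : (1 : ℝ) ≤ 2) hk'le)
              (by positivity)
          _ = (2 : ℝ) ^ (-1 : ℤ) := by
            rw [← zpow_add₀ two_ne_zero, ← zpow_add₀ two_ne_zero]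
            congr 1
            ring
    linarith
  · -- upper bound: otherwise `2 ≤ 2^{-k} 2^{-N} 2^{k'-1} ≤ 2^{-k}ρ‖ξ‖`
    by_contra hlt
    push Not at hlt
    have hk'ge : k + N + 1 ≤ k' - 1 := by omega
    have : (2 : ℝ) ^ (1 : ℤ) ≤ (2 : ℝ) ^ (-k) * ρ * ‖ξ‖ := by
      calc (2 : ℝ) ^ (1 : ℤ) = (2 : ℝ) ^ (-k) * (2 : ℝ) ^ (-(N : ℤ)) * (2 : ℝ) ^ (k + N + 1) := by
            rw [← zpow_add₀ two_ne_zero, ← zpow_add₀ two_ne_zero]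
            congr 1
            ring
        _ ≤ (2 : ℝ) ^ (-k) * (2 : ℝ) ^ (-(N : ℤ)) * (2 : ℝ) ^ (k' - 1) :=
            mul_le_mul_of_nonneg_left (zpow_le_zpow_right₀ (one_le_two : (1 : ℝ) ≤ 2) hk'ge)
              (by positivity)
        _ ≤ (2 : ℝ) ^ (-k) * ρ * ‖ξ‖ := by
            gcongr
    rw [zpow_one] at this
    linarith

omit [FiniteDimensional ℝ E] in
/-- **The annular bump as a finite sum of its products with the dyadic symbols**:
`φ₀(2^{-k}ρ L ξ) = ∑_{|k'-k| ≤ N+1} φ_{k'}(ξ) φ₀(2^{-k}ρ L ξ)` for every `ξ` (dyadic partition of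
unity on the support). -/
theorem annular_eq_sum {N : ℕ} {ρ : ℝ} (hρ₁ : (2 : ℝ) ^ (-(N : ℤ)) ≤ ρ) (hρ₂ : ρ ≤ (2 : ℝ) ^ (N : ℤ))
    (L : E ≃ₗᵢ[ℝ] E) (k : ℤ) (ξ : E) :
    dyadicSymbol 0 ((((2 : ℝ) ^ (-k)) * ρ) • L ξ) =
      ∑ k' ∈ Finset.Icc (k - (N + 1 : ℕ)) (k + (N + 1 : ℕ)),
        dyadicSymbol k' ξ * dyadicSymbol 0 ((((2 : ℝ) ^ (-k)) * ρ) • L ξ) := by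
  by_cases hg : dyadicSymbol 0 ((((2 : ℝ) ^ (-k)) * ρ) • L ξ) = 0
  · rw [hg]
    simp only [mul_zero, Finset.sum_const_zero]
  · have hξ : ξ ≠ 0 := by
      rintro rfl
      apply hg
      rw [map_zero, smul_zero]
      exact dyadicSymbol_apply_of_norm_le_holds (by rw [norm_zero]; positivity)
    have hsum : HasSum (fun k' : ℤ => dyadicSymbol k' ξ) 1 := sum_dyadicSymbol_holds hξ
    have hfin : HasSum (fun k' : ℤ => dyadicSymbol k' ξ)
        (∑ k' ∈ Finset.Icc (k - (N + 1 : ℕ)) (k + (N + 1 : ℕ)), dyadicSymbol k' ξ) := by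
      refine hasSum_sum_of_ne_finset_zero fun k' hk' => ?_
      by_contra hne
      exact hk' (mem_Icc_of_annular_ne_zero hρ₁ hρ₂ L hg hne)
    have h1 : ∑ k' ∈ Finset.Icc (k - (N + 1 : ℕ)) (k + (N + 1 : ℕ)), dyadicSymbol k' ξ = 1 :=
      hfin.unique hsum
    rw [← Finset.sum_mul, h1, one_mul]

/-- The annular bump is a smooth compactly supported function, hence of temperate growth. -/
theorem hasTemperateGrowth_annular (c : ℝ) (L : E ≃ₗᵢ[ℝ] E) :
    (fun ξ : E => dyadicSymbol 0 (c • L ξ)).HasTemperateGrowth :=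
  (hasTemperateGrowth_dyadicSymbol 0).comp
    ((c • L.toContinuousLinearEquiv.toContinuousLinearMap).hasTemperateGrowth)

variable [MeasurableSpace E] [BorelSpace E] {F : Type*} [NormedAddCommGroup F] [NormedSpace ℂ F] [CompleteSpace F]

/-! ### The annular multipliers on `L^∞` -/

/-- **Annular multipliers are controlled by the neighbouring blocks**: for every `N` there is `C`
such that for `2^{-N} ≤ ρ ≤ 2^N`, every linear isometry `L`, every `k ∈ ℤ` and `u ∈ 𝓢'(E, F)`,
`‖φ₀(2^{-k}ρ L D) u‖_{L^∞} ≤ C ∑_{|k'-k| ≤ N+1} ‖Δ̇_{k'} u‖_{L^∞}`. -/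
theorem exists_eLpNormDistrib_annularMultiplier_le (N : ℕ) :
    ∃ C : ℝ≥0, ∀ (ρ : ℝ), (2 : ℝ) ^ (-(N : ℤ)) ≤ ρ → ρ ≤ (2 : ℝ) ^ (N : ℤ) →
      ∀ (L : E ≃ₗᵢ[ℝ] E) (k : ℤ) (u : 𝓢'(E, F)),
        eLpNormDistrib ∞ (fourierMultiplierCLM F
          (fun ξ : E => dyadicSymbol 0 ((((2 : ℝ) ^ (-k)) * ρ) • L ξ)) u) ≤
          C * ∑ k' ∈ Finset.Icc (k - (N + 1 : ℕ)) (k + (N + 1 : ℕ)), eLpNormDistrib ∞ (lpBlock k' u) := by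
  obtain ⟨n, C, hC⟩ := exists_eLpNormDistrib_fourierMultiplierCLM_lpBlock_le (E := E) (F := F) ∞
  obtain ⟨Q, hQ0, hQ⟩ := exists_norm_iteratedFDeriv_dyadicSymbol_comp_le (E := E) n
  set B : ℝ := Q * ((2 : ℝ) ^ (2 * N + 1)) ^ n with hB
  have hB0 : 0 ≤ B := by positivity
  refine ⟨C * B.toNNReal, fun ρ hρ₁ hρ₂ L k u => ?_⟩
  have hρ0 : 0 < ρ := lt_of_lt_of_le (zpow_pos two_pos _) hρ₁
  set c : ℝ := (2 : ℝ) ^ (-k) * ρ with hc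
  set g : E → ℂ := fun ξ : E => dyadicSymbol 0 (c • L ξ) with hgdef
  have hg : g.HasTemperateGrowth := hasTemperateGrowth_annular c L
  set S : Finset ℤ := Finset.Icc (k - (N + 1 : ℕ)) (k + (N + 1 : ℕ)) with hS
  -- the operator as a finite sum over the neighbouring blocks
  have hop : fourierMultiplierCLM F g u = ∑ k' ∈ S, fourierMultiplierCLM F g (lpBlock k' u) := by
    set gfam : ℤ → E → ℂ := fun k' => dyadicSymbol k' * g with hgfam
    have hfun : g = fun ξ => ∑ k' ∈ S, gfam k' ξ := by
      funext ξ
      simp only [hgfam, Pi.mul_apply]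
      exact annular_eq_sum hρ₁ hρ₂ L k ξ
    conv_lhs => rw [hfun]
    rw [TemperedDistribution.fourierMultiplierCLM_sum F
      (fun k' _ => (hasTemperateGrowth_dyadicSymbol k').mul hg), FunLike.coe_sum, Finset.sum_apply]
    refine Finset.sum_congr rfl fun k' _ => ?_
    rw [lpBlock_apply, TemperedDistribution.fourierMultiplierCLM_fourierMultiplierCLM_apply
      (hasTemperateGrowth_dyadicSymbol k') hg]
  -- each piece is an admissible multiplier on `Δ̇_{k'}`
  have hpiece : ∀ k' ∈ S, eLpNormDistrib ∞ (fourierMultiplierCLM F g (lpBlock k' u)) ≤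
      C * ENNReal.ofReal B * eLpNormDistrib ∞ (lpBlock k' u) := by
    intro k' hk'
    have hk'' : k' - k ≤ (N : ℤ) + 1 ∧ k - k' ≤ (N : ℤ) + 1 := by
      rw [hS, Finset.mem_Icc] at hk'; push_cast at hk'; omega
    set L' : E →L[ℝ] E := ((2 : ℝ) ^ k' * c) • L.toContinuousLinearEquiv.toContinuousLinearMap with hL'
    have hresc : (fun ξ : E => g (((2 : ℝ) ^ k') • ξ)) = fun ξ => dyadicSymbol 0 (L' ξ) := by
      funext ξ
      simp only [hgdef, hL', FunLike.coe_smul, Pi.smul_apply, map_smul, smul_smul]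
      congr 1
      rw [mul_comm]
      rfl
    have hL'n : ‖L'‖ ≤ (2 : ℝ) ^ (2 * N + 1) := by
      rw [hL', norm_smul, Real.norm_of_nonneg (by positivity)]
      calc (2 : ℝ) ^ k' * c * ‖(L.toContinuousLinearEquiv : E →L[ℝ] E)‖
          ≤ (2 : ℝ) ^ k' * c * 1 := by
            gcongr
            exact L.toContinuousLinearEquiv.toContinuousLinearMap.opNorm_le_bound zero_le_one
              fun x => by simp
        _ = (2 : ℝ) ^ (k' - k) * ρ := by
            rw [hc, mul_one, ← mul_assoc, ← zpow_add₀ two_ne_zero, sub_eq_add_neg]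
        _ ≤ (2 : ℝ) ^ ((N : ℤ) + 1) * (2 : ℝ) ^ (N : ℤ) :=
            mul_le_mul (zpow_le_zpow_right₀ (one_le_two : (1 : ℝ) ≤ 2) hk''.1) hρ₂ hρ0.le
              (by positivity)
        _ = (2 : ℝ) ^ (2 * N + 1) := by
            rw [← zpow_add₀ two_ne_zero, ← zpow_natCast]
            congr 1
            push_cast
            ring
    have hderiv : ∀ N' ≤ n, ∀ x ∈ blockAnnulus E,
        ‖iteratedFDeriv ℝ N' (fun ξ : E => g (((2 : ℝ) ^ k') • ξ)) x‖ ≤ B := by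
      intro N' hN' x _
      rw [hresc]
      refine (hQ L' N' hN' x).trans ?_
      rw [hB]
      gcongr
      exact max_le (one_le_pow₀ one_le_two) hL'n
    exact hC g hg k' B hB0 hderiv u
  -- sum up
  rw [hop]
  have hsum : ∀ T : Finset ℤ, T ⊆ S →
      eLpNormDistrib ∞ (∑ k' ∈ T, fourierMultiplierCLM F g (lpBlock k' u)) ≤
        ∑ k' ∈ T, C * ENNReal.ofReal B * eLpNormDistrib ∞ (lpBlock k' u) := by
    classical
    intro T hT
    induction T using Finset.induction_on with
    | empty => simp
    | insert a T ha ih =>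
      rw [Finset.sum_insert ha, Finset.sum_insert ha]
      exact (eLpNormDistrib_add_le _ _).trans (add_le_add
        (hpiece a (hT (Finset.mem_insert_self a T)))
        (ih (fun x hx => hT (Finset.mem_insert_of_mem hx))))
  refine (hsum S subset_rfl).trans_eq ?_
  rw [Finset.mul_sum]
  refine Finset.sum_congr rfl fun k' _ => ?_
  rw [ENNReal.coe_mul]
  simp only [ENNReal.ofReal, mul_assoc]

/-! ### Summing over the frequencies -/

/-- **Shifted finite windows sum to a multiple of the full sum**:
`∑_k ∑_{|k'-k| ≤ M} a_{k'} = (2M+1) ∑_k a_k` in `[0, ∞]`. -/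
theorem tsum_sum_Icc_shift (a : ℤ → ℝ≥0∞) (M : ℕ) :
    ∑' k : ℤ, ∑ k' ∈ Finset.Icc (k - M) (k + M), a k' = (2 * M + 1) * ∑' k : ℤ, a k := by
  have hwin : ∀ k : ℤ, ∑ k' ∈ Finset.Icc (k - M) (k + M), a k' =
      ∑ d ∈ Finset.Icc (-(M : ℤ)) M, a (k + d) := by
    intro k
    have himage : Finset.Icc (k - M) (k + M) = (Finset.Icc (-(M : ℤ)) M).image (k + ·) := by
      ext k'
      simp only [Finset.mem_Icc, Finset.mem_image]
      constructor
      · intro h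
        exact ⟨k' - k, by omega, by omega⟩
      · rintro ⟨d, hd, rfl⟩
        omega
    rw [himage, Finset.sum_image fun x _ y _ h => by simpa using h]
  simp_rw [hwin]
  rw [Summable.tsum_finsetSum fun _ _ => ENNReal.summable]
  have hshift : ∀ d : ℤ, ∑' k : ℤ, a (k + d) = ∑' k : ℤ, a k := fun d =>
    (Equiv.addRight d).tsum_eq a
  simp_rw [hshift]
  rw [Finset.sum_const, Int.card_Icc, nsmul_eq_mul]
  congr 1
  have : ((M : ℤ) + 1 - -(M : ℤ)).toNat = 2 * M + 1 := by omega
  rw [this]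
  push_cast
  ring

/-- **Annular multipliers are bounded from `Ḃ⁰_{∞,1}` to `ℓ¹(L^∞)`**: for every `N` there is `C`
such that for `2^{-N} ≤ ρ ≤ 2^N`, every linear isometry `L` and every `u ∈ 𝓢'(E, F)`,
`∑_k ‖φ₀(2^{-k}ρ L D) u‖_{L^∞} ≤ C ‖u‖_{Ḃ⁰_{∞,1}}` — the block-level statement that rotations and
dilations with factor in a compact range are bounded on `Ḃ⁰_{∞,1}`. -/
theorem exists_tsum_eLpNormDistrib_annularMultiplier_le (N : ℕ) :
    ∃ C : ℝ≥0, ∀ (ρ : ℝ), (2 : ℝ) ^ (-(N : ℤ)) ≤ ρ → ρ ≤ (2 : ℝ) ^ (N : ℤ) →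
      ∀ (L : E ≃ₗᵢ[ℝ] E) (u : 𝓢'(E, F)),
        ∑' k : ℤ, eLpNormDistrib ∞ (fourierMultiplierCLM F
          (fun ξ : E => dyadicSymbol 0 ((((2 : ℝ) ^ (-k)) * ρ) • L ξ)) u) ≤
          C * eHomBesovNorm 0 ∞ 1 u := by
  obtain ⟨C, hC⟩ := exists_eLpNormDistrib_annularMultiplier_le (E := E) (F := F) N
  refine ⟨C * (2 * (N + 1 : ℕ) + 1), fun ρ hρ₁ hρ₂ L u => ?_⟩
  calc ∑' k : ℤ, eLpNormDistrib ∞ (fourierMultiplierCLM F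
        (fun ξ : E => dyadicSymbol 0 ((((2 : ℝ) ^ (-k)) * ρ) • L ξ)) u)
      ≤ ∑' k : ℤ, C * ∑ k' ∈ Finset.Icc (k - (N + 1 : ℕ)) (k + (N + 1 : ℕ)),
          eLpNormDistrib ∞ (lpBlock k' u) := ENNReal.tsum_le_tsum fun k => hC ρ hρ₁ hρ₂ L k u
    _ = C * ((2 * (N + 1 : ℕ) + 1) * ∑' k : ℤ, eLpNormDistrib ∞ (lpBlock k u)) := by
        rw [ENNReal.tsum_mul_left, tsum_sum_Icc_shift]
    _ = ((C * (2 * (N + 1 : ℕ) + 1) : ℝ≥0) : ℝ≥0∞) * eHomBesovNorm 0 ∞ 1 u := by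
        rw [eHomBesovNorm_zero_one_eq_tsum, ENNReal.coe_mul]
        push_cast
        ring

end Summit.NavierStokesRegularity.NavierStokesRegularity.Theorems.PerpetualPumpThesis.FA

namespace Summit.NavierStokesRegularity.NavierStokesRegularity.Theorems.PerpetualPumpThesis

open Literature.Analysis.FluidPDE Literature.Analysis.FluidPDE.Tao2016
open Literature.Analysis.FunctionSpaces

/-- **Part Annular of stub `besovDuhamelBound` (registered sub-goal `stub_FA_Annular`)**: the
annular multipliers `φ₀(2^{-k}ρ L D)` (rotated, non-dyadically dilated blocks, `2^{-N} ≤ ρ ≤ 2^N`,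
`L` a linear isometry of `ℝ³`) are bounded from `Ḃ⁰_{∞,1}(ℝ³; ℂ³)` to `ℓ¹(L^∞)`, uniformly:
`∑_k ‖φ₀(2^{-k}ρ L D) u‖_{L^∞} ≤ C_N ‖u‖_{Ḃ⁰_{∞,1}}`. -/
theorem stub_FA_Annular : ∀ N : ℕ, ∃ C : NNReal, ∀ (ρ : ℝ), (2 : ℝ) ^ (-(N : ℤ)) ≤ ρ → ρ ≤ (2 : ℝ) ^ (N : ℤ) → ∀ (L : EuclideanSpace ℝ (Fin 3) ≃ₗᵢ[ℝ] EuclideanSpace ℝ (Fin 3)) (u : 𝓢'(EuclideanSpace ℝ (Fin 3), EuclideanSpace ℂ (Fin 3))), ∑' k : ℤ, eLpNormDistrib ⊤ (TemperedDistribution.fourierMultiplierCLM (EuclideanSpace ℂ (Fin 3)) (fun ξ : EuclideanSpace ℝ (Fin 3) => dyadicSymbol 0 ((((2 : ℝ) ^ (-k)) * ρ) • L ξ)) u) ≤ (C : ENNReal) * eHomBesovNorm 0 ⊤ 1 u :=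
  fun N => FA.exists_tsum_eLpNormDistrib_annularMultiplier_le N

end Summit.NavierStokesRegularity.NavierStokesRegularity.Theorems.PerpetualPumpThesis
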